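import Literature.Analysis.FunctionSpaces.TorusInverseLaplacianCalculus
import Literature.Analysis.FunctionSpaces.TorusTestFunction
import Literature.Analysis.FunctionSpaces.TorusSpaceTime
import HarnessLib

/-!
# Differentiating the linearised compressible Euler operator once in space

Analysis/FluidPDE support file (everything proved; no named facts), part of the programme
proving `Literature.Analysis.FluidPDE.CompressibleEulerLocalWellPosedness` (Majda 1984,
Thms 2.1–2.2). The higher-order energy estimates of the energy method (Majda 1984, Ch. 2 §2.1,
proof of Thm 2.1: "apply `∂^α` to the equations and estimate the commutators") rest on the
elementary observation that a space derivative `∂ⱼ` of the linearised (acoustic) operator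

  `L₁(r, w) = ∂ₜr + ∑ᵢ vᵢ ∂ᵢr + c div w`,
  `L₂(r, w, θ) = ∂ₜw + ∑ᵢ vᵢ ∂ᵢw + a ∇r + b ∇θ`,
  `L₃(θ, w) = ∂ₜθ + ∑ᵢ vᵢ ∂ᵢθ + g div w`

is the same operator applied to `(∂ⱼr, ∂ⱼw, ∂ⱼθ)` plus ZEROTH-order terms in the derivatives
of `(r, w, θ)` whose coefficients are first derivatives of `(v, a, b, c, g)`:

  `∂ⱼ[L₁(r, w)] = L₁(∂ⱼr, ∂ⱼw) + (∑ᵢ ∂ⱼvᵢ ∂ᵢr + ∂ⱼc div w)`            (`partialDeriv_res₁`),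
  `∂ⱼ[L₂(r, w, θ)] = L₂(∂ⱼr, ∂ⱼw, ∂ⱼθ) + (∑ᵢ ∂ⱼvᵢ ∂ᵢw + ∂ⱼa ∇r + ∂ⱼb ∇θ)` (`partialDeriv_res₂`),
  `∂ⱼ[L₃(θ, w)] = L₃(∂ⱼθ, ∂ⱼw) + (∑ᵢ ∂ⱼvᵢ ∂ᵢθ + ∂ⱼg div w)`            (`partialDeriv_res₃`),

for jointly smooth fields on a slab `[t₀, t₁] × 𝕋^d` (mixed partials commute, including
`∂ⱼ∂ₜ = ∂ₜ∂ⱼ` for the one-sided time derivative within `[t₀, t₁]`,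
`Torus.timeDerivWithin_partialDeriv_comm`). Iterating, the fields `∂^α(ρ, u, ϑ)` of a smooth
solution satisfy the linearised system up to commutator residuals built from lower-order
derivatives, which is the input of the `H³` energy estimate. The space-only identities
(`partialDeriv_gradient_eq`, `partialDeriv_divergence_eq`, `partialDeriv_transport`,
`partialDeriv_transport_smul`, `partialDeriv_mul_divergence`, `partialDeriv_smul_gradient`) are
recorded separately.

## References

* A. Majda, *Compressible Fluid Flow and Systems of Conservation Laws in Several Space
  Variables*, Springer 1984, Ch. 2 §2.1, proof of Thm 2.1 (commutator structure of `∂^α` of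
  the system), Thm 2.2. [`Majda1984`]
-/

noncomputable section

open Set Function
open scoped ContDiff

namespace Literature.Analysis.FluidPDE

namespace CompressibleEuler

open Literature.Analysis.FunctionSpaces FunctionSpaces.Torus

variable {d : Type*} [Fintype d] [DecidableEq d]
variable {F : Type*} [NormedAddCommGroup F] [NormedSpace ℝ F]

/-! ## Space derivatives of gradient, divergence and transport terms -/

section Space

omit [DecidableEq d] in
/-- Finite sums of smooth torus functions, written pointwise, are smooth. [folklore] -/
theorem isSmooth_fun_sum {ι : Type*} (s : Finset ι) {f : ι → UnitAddTorus d → F}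
    (h : ∀ i ∈ s, IsSmooth (f i)) : IsSmooth (fun y => ∑ i ∈ s, f i y) :=
  (ContDiff.sum fun i hi => (h i hi : ContDiff ℝ ∞ (lift (f i))) : IsSmooth fun y => ∑ i ∈ s, f i y)

/-- `∂ⱼ` commutes with the gradient of a smooth scalar: `∂ⱼ(∇r) = ∇(∂ⱼr)`. [folklore] -/
theorem partialDeriv_gradient_eq {r : UnitAddTorus d → ℝ} (hr : IsSmooth r) (j : d) (x : UnitAddTorus d) :
    partialDeriv j (gradient r) x = gradient (partialDeriv j r) x := by
  have e : gradient r = fun y => ∑ i, partialDeriv i r y • EuclideanSpace.single i (1 : ℝ) :=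
    funext fun y => gradient_eq_sum_partialDeriv (hr.isContDiff (by simp)) y
  have hs : ∀ i, IsSmooth (fun y => partialDeriv i r y • EuclideanSpace.single i (1 : ℝ)) := fun i =>
    (hr.partialDeriv i).smul' (isSmooth_const _)
  rw [e, partialDeriv_finset_sum _ (fun i _ => (hs i).isContDiff (by simp)),
    gradient_eq_sum_partialDeriv ((hr.partialDeriv j).isContDiff (by simp))]
  refine Finset.sum_congr rfl fun i _ => ?_
  have h0 : partialDeriv j (fun _ : UnitAddTorus d => EuclideanSpace.single i (1 : ℝ)) x = 0 := by
    simp [partialDeriv, Torus.lineDeriv]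
  rw [partialDeriv_smul ((hr.partialDeriv i).isContDiff (by simp)) (isContDiff_const _),
    partialDeriv_comm hr j i x, h0, smul_zero, zero_add]

/-- The components of `∂ⱼw` are the `∂ⱼ` of the components (as functions). [folklore] -/
theorem partialDeriv_apply_coord_fun {w : UnitAddTorus d → EuclideanSpace ℝ d} (hw : IsSmooth w)
    (j i : d) : (fun y => partialDeriv j w y i) = partialDeriv j (fun z => w z i) :=
  funext fun y => (partialDeriv_apply_coord (hw.isContDiff (by simp)) j y i).symm

/-- `∂ⱼ` commutes with the divergence of a smooth field: `∂ⱼ(div w) = div(∂ⱼw)`. [folklore] -/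
theorem partialDeriv_divergence_eq {w : UnitAddTorus d → EuclideanSpace ℝ d} (hw : IsSmooth w) (j : d)
    (x : UnitAddTorus d) :
    partialDeriv j (divergence w) x = divergence (partialDeriv j w) x := by
  have e : divergence w = fun y => ∑ i, partialDeriv i (fun z => w z i) y := by
    funext y; simp only [divergence]
  rw [e, partialDeriv_finset_sum _ (fun i _ => ((hw.apply i).partialDeriv i).isContDiff (by simp))]
  simp only [divergence]
  refine Finset.sum_congr rfl fun i _ => ?_
  rw [partialDeriv_comm (hw.apply i) j i x, partialDeriv_apply_coord_fun hw j i]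

variable {v : UnitAddTorus d → EuclideanSpace ℝ d}

/-- `∂ⱼ` of a vector transport term:
`∂ⱼ(∑ᵢ vᵢ ∂ᵢw) = ∑ᵢ (∂ⱼv)ᵢ ∂ᵢw + ∑ᵢ vᵢ ∂ᵢ(∂ⱼw)`. [folklore] -/
theorem partialDeriv_transport_smul (hv : IsSmooth v) {w : UnitAddTorus d → F} (hw : IsSmooth w) (j : d)
    (x : UnitAddTorus d) :
    partialDeriv j (fun y => ∑ i, v y i • partialDeriv i w y) x =
      (∑ i, partialDeriv j v x i • partialDeriv i w x) + ∑ i, v x i • partialDeriv i (partialDeriv j w) x := by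
  have hs : ∀ i, IsSmooth (fun y => v y i • partialDeriv i w y) := fun i => (hv.apply i).smul' (hw.partialDeriv i)
  rw [partialDeriv_finset_sum _ (fun i _ => (hs i).isContDiff (by simp)), ← Finset.sum_add_distrib]
  refine Finset.sum_congr rfl fun i _ => ?_
  rw [partialDeriv_smul ((hv.apply i).isContDiff (by simp)) ((hw.partialDeriv i).isContDiff (by simp)),
    partialDeriv_apply_coord (hv.isContDiff (by simp)) j x i, partialDeriv_comm hw j i x, add_comm]

/-- `∂ⱼ` of a scalar transport term:
`∂ⱼ(∑ᵢ vᵢ ∂ᵢr) = ∑ᵢ (∂ⱼv)ᵢ ∂ᵢr + ∑ᵢ vᵢ ∂ᵢ(∂ⱼr)`. [folklore] -/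
theorem partialDeriv_transport (hv : IsSmooth v) {r : UnitAddTorus d → ℝ} (hr : IsSmooth r) (j : d)
    (x : UnitAddTorus d) :
    partialDeriv j (fun y => ∑ i, v y i * partialDeriv i r y) x =
      (∑ i, partialDeriv j v x i * partialDeriv i r x) + ∑ i, v x i * partialDeriv i (partialDeriv j r) x := by
  have h := partialDeriv_transport_smul hv hr j x
  simpa only [smul_eq_mul] using h

/-- `∂ⱼ(c · div w) = ∂ⱼc · div w + c · div(∂ⱼw)`. [folklore] -/
theorem partialDeriv_mul_divergence {c : UnitAddTorus d → ℝ} (hc : IsSmooth c)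
    {w : UnitAddTorus d → EuclideanSpace ℝ d} (hw : IsSmooth w) (j : d) (x : UnitAddTorus d) :
    partialDeriv j (fun y => c y * divergence w y) x =
      partialDeriv j c x * divergence w x + c x * divergence (partialDeriv j w) x := by
  have hdiv : IsSmooth (divergence w) := hw.divergence
  rw [partialDeriv_mul (hc.isContDiff (by simp)) (hdiv.isContDiff (by simp)),
    partialDeriv_divergence_eq hw j x, add_comm]

/-- `∂ⱼ(a • ∇r) = ∂ⱼa • ∇r + a • ∇(∂ⱼr)`. [folklore] -/
theorem partialDeriv_smul_gradient {a r : UnitAddTorus d → ℝ} (ha : IsSmooth a) (hr : IsSmooth r) (j : d)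
    (x : UnitAddTorus d) :
    partialDeriv j (fun y => a y • gradient r y) x =
      partialDeriv j a x • gradient r x + a x • gradient (partialDeriv j r) x := by
  have hg : IsSmooth (gradient r) := hr.gradient
  rw [partialDeriv_smul (ha.isContDiff (by simp)) (hg.isContDiff (by simp)),
    partialDeriv_gradient_eq hr j x, add_comm]

end Space

/-! ## Differentiating the three linearised equations -/

section SpaceTime

variable {t₀ t₁ : ℝ} {r θ a b c g : ℝ → UnitAddTorus d → ℝ}
  {w v : ℝ → UnitAddTorus d → EuclideanSpace ℝ d}

/-- **`∂ⱼ` of the linearised continuity equation**: on a slab `[t₀, t₁] × 𝕋^d` (`t₀ < t₁`),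
`∂ⱼ[∂ₜr + ∑ᵢ vᵢ∂ᵢr + c div w] = (∂ₜ(∂ⱼr) + ∑ᵢ vᵢ∂ᵢ(∂ⱼr) + c div(∂ⱼw)) + (∑ᵢ (∂ⱼv)ᵢ ∂ᵢr + ∂ⱼc div w)`.
[cite: Majda1984, Ch. 2 §2.1, proof of Thm 2.1] -/
theorem partialDeriv_res₁ (ht : t₀ < t₁) (hr : IsSmoothSpaceTimeOn (Icc t₀ t₁) r)
    (hw : IsSmoothSpaceTimeOn (Icc t₀ t₁) w) (hv : IsSmoothSpaceTimeOn (Icc t₀ t₁) v)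
    (hc : IsSmoothSpaceTimeOn (Icc t₀ t₁) c) {t : ℝ} (hts : t ∈ Icc t₀ t₁) (j : d) (x : UnitAddTorus d) :
    partialDeriv j (fun y => timeDerivWithin (Icc t₀ t₁) r t y + (∑ i, v t y i * partialDeriv i (r t) y) +
        c t y * divergence (w t) y) x =
      (timeDerivWithin (Icc t₀ t₁) (fun s => partialDeriv j (r s)) t x +
          (∑ i, v t x i * partialDeriv i (partialDeriv j (r t)) x) +
          c t x * divergence (partialDeriv j (w t)) x) +
        ((∑ i, partialDeriv j (v t) x i * partialDeriv i (r t) x) + partialDeriv j (c t) x * divergence (w t) x) := by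
  have hS : UniqueDiffOn ℝ (Icc t₀ t₁) := uniqueDiffOn_Icc ht
  have hrt : IsSmooth (r t) := hr.isSmooth_slice hts
  have hwt : IsSmooth (w t) := hw.isSmooth_slice hts
  have hvt : IsSmooth (v t) := hv.isSmooth_slice hts
  have hct : IsSmooth (c t) := hc.isSmooth_slice hts
  have hA : IsSmooth (timeDerivWithin (Icc t₀ t₁) r t) := (hr.timeDerivWithin hS).isSmooth_slice hts
  have hB : IsSmooth (fun y => ∑ i, v t y i * partialDeriv i (r t) y) :=
    isSmooth_fun_sum _ fun i _ => (ContDiff.mul (hvt.apply i) (hrt.partialDeriv i) :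
      IsSmooth fun y => v t y i * partialDeriv i (r t) y)
  have hC : IsSmooth (fun y => c t y * divergence (w t) y) :=
    (ContDiff.mul hct hwt.divergence : IsSmooth fun y => c t y * divergence (w t) y)
  have e : (fun y => timeDerivWithin (Icc t₀ t₁) r t y + (∑ i, v t y i * partialDeriv i (r t) y) +
      c t y * divergence (w t) y) =
      (timeDerivWithin (Icc t₀ t₁) r t + fun y => ∑ i, v t y i * partialDeriv i (r t) y) +
        fun y => c t y * divergence (w t) y := rfl
  rw [e, partialDeriv_add ((hA.add hB).isContDiff (by simp)) (hC.isContDiff (by simp)),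
    partialDeriv_add (hA.isContDiff (by simp)) (hB.isContDiff (by simp))]
  simp only [Pi.add_apply]
  rw [← timeDerivWithin_partialDeriv_comm ht hr hts j x, partialDeriv_transport hvt hrt j x,
    partialDeriv_mul_divergence hct hwt j x]
  ring

/-- **`∂ⱼ` of the linearised momentum equation**:
`∂ⱼ[∂ₜw + ∑ᵢ vᵢ∂ᵢw + a∇r + b∇θ] = (∂ₜ(∂ⱼw) + ∑ᵢ vᵢ∂ᵢ(∂ⱼw) + a∇(∂ⱼr) + b∇(∂ⱼθ))
  + (∑ᵢ (∂ⱼv)ᵢ ∂ᵢw + ∂ⱼa ∇r + ∂ⱼb ∇θ)`. [cite: Majda1984, Ch. 2 §2.1, proof of Thm 2.1] -/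
theorem partialDeriv_res₂ (ht : t₀ < t₁) (hr : IsSmoothSpaceTimeOn (Icc t₀ t₁) r)
    (hθ : IsSmoothSpaceTimeOn (Icc t₀ t₁) θ) (hw : IsSmoothSpaceTimeOn (Icc t₀ t₁) w)
    (hv : IsSmoothSpaceTimeOn (Icc t₀ t₁) v) (ha : IsSmoothSpaceTimeOn (Icc t₀ t₁) a)
    (hb : IsSmoothSpaceTimeOn (Icc t₀ t₁) b) {t : ℝ} (hts : t ∈ Icc t₀ t₁) (j : d) (x : UnitAddTorus d) :
    partialDeriv j (fun y => timeDerivWithin (Icc t₀ t₁) w t y + (∑ i, v t y i • partialDeriv i (w t) y) +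
        a t y • gradient (r t) y + b t y • gradient (θ t) y) x =
      (timeDerivWithin (Icc t₀ t₁) (fun s => partialDeriv j (w s)) t x +
          (∑ i, v t x i • partialDeriv i (partialDeriv j (w t)) x) +
          a t x • gradient (partialDeriv j (r t)) x + b t x • gradient (partialDeriv j (θ t)) x) +
        ((∑ i, partialDeriv j (v t) x i • partialDeriv i (w t) x) +
          partialDeriv j (a t) x • gradient (r t) x + partialDeriv j (b t) x • gradient (θ t) x) := by
  have hS : UniqueDiffOn ℝ (Icc t₀ t₁) := uniqueDiffOn_Icc ht
  have hrt : IsSmooth (r t) := hr.isSmooth_slice hts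
  have hθt : IsSmooth (θ t) := hθ.isSmooth_slice hts
  have hwt : IsSmooth (w t) := hw.isSmooth_slice hts
  have hvt : IsSmooth (v t) := hv.isSmooth_slice hts
  have hat : IsSmooth (a t) := ha.isSmooth_slice hts
  have hbt : IsSmooth (b t) := hb.isSmooth_slice hts
  have hA : IsSmooth (timeDerivWithin (Icc t₀ t₁) w t) := (hw.timeDerivWithin hS).isSmooth_slice hts
  have hB : IsSmooth (fun y => ∑ i, v t y i • partialDeriv i (w t) y) :=
    isSmooth_fun_sum _ fun i _ => (hvt.apply i).smul' (hwt.partialDeriv i)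
  have hC : IsSmooth (fun y => a t y • gradient (r t) y) := hat.smul' hrt.gradient
  have hD : IsSmooth (fun y => b t y • gradient (θ t) y) := hbt.smul' hθt.gradient
  have e : (fun y => timeDerivWithin (Icc t₀ t₁) w t y + (∑ i, v t y i • partialDeriv i (w t) y) +
      a t y • gradient (r t) y + b t y • gradient (θ t) y) =
      ((timeDerivWithin (Icc t₀ t₁) w t + fun y => ∑ i, v t y i • partialDeriv i (w t) y) +
        fun y => a t y • gradient (r t) y) + fun y => b t y • gradient (θ t) y := rfl
  rw [e, partialDeriv_add (((hA.add hB).add hC).isContDiff (by simp)) (hD.isContDiff (by simp)),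
    partialDeriv_add ((hA.add hB).isContDiff (by simp)) (hC.isContDiff (by simp)),
    partialDeriv_add (hA.isContDiff (by simp)) (hB.isContDiff (by simp))]
  simp only [Pi.add_apply]
  rw [← timeDerivWithin_partialDeriv_comm ht hw hts j x, partialDeriv_transport_smul hvt hwt j x,
    partialDeriv_smul_gradient hat hrt j x, partialDeriv_smul_gradient hbt hθt j x]
  abel

/-- **`∂ⱼ` of the linearised temperature equation**:
`∂ⱼ[∂ₜθ + ∑ᵢ vᵢ∂ᵢθ + g div w] = (∂ₜ(∂ⱼθ) + ∑ᵢ vᵢ∂ᵢ(∂ⱼθ) + g div(∂ⱼw)) + (∑ᵢ (∂ⱼv)ᵢ ∂ᵢθ + ∂ⱼg div w)`.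
[cite: Majda1984, Ch. 2 §2.1, proof of Thm 2.1] -/
theorem partialDeriv_res₃ (ht : t₀ < t₁) (hθ : IsSmoothSpaceTimeOn (Icc t₀ t₁) θ)
    (hw : IsSmoothSpaceTimeOn (Icc t₀ t₁) w) (hv : IsSmoothSpaceTimeOn (Icc t₀ t₁) v)
    (hg : IsSmoothSpaceTimeOn (Icc t₀ t₁) g) {t : ℝ} (hts : t ∈ Icc t₀ t₁) (j : d) (x : UnitAddTorus d) :
    partialDeriv j (fun y => timeDerivWithin (Icc t₀ t₁) θ t y + (∑ i, v t y i * partialDeriv i (θ t) y) +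
        g t y * divergence (w t) y) x =
      (timeDerivWithin (Icc t₀ t₁) (fun s => partialDeriv j (θ s)) t x +
          (∑ i, v t x i * partialDeriv i (partialDeriv j (θ t)) x) +
          g t x * divergence (partialDeriv j (w t)) x) +
        ((∑ i, partialDeriv j (v t) x i * partialDeriv i (θ t) x) + partialDeriv j (g t) x * divergence (w t) x) :=
  partialDeriv_res₁ ht hθ hw hv hg hts j x

end SpaceTime

end CompressibleEuler

end Literature.Analysis.FluidPDE

end
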